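import Summits.ValiantsHypothesis.ValiantsHypothesis.Theorems.BarrierLeverAnchoredDoorHitsLowerPairsDistinctAnchors
import Summits.ValiantsHypothesis.ValiantsHypothesis.Theorems.BarrierLeverAnchoredDoorHitsLowerPairsXElimCheck
import Summits.ValiantsHypothesis.ValiantsHypothesis.Theorems.BarrierLeverAnchoredDoorHitsLowerPairsMono

/-!
# Support item `AnchoredDoorHitsLowerPairs` (stmt-ValiantsHypothesis-22510), line `anchored-peeling`:
# DISTINCT-ANCHOR CERTIFICATES FROM DATA — a `decide`-able checker for the system-of-distinct-anchors certificate of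
# `…DistinctAnchors` (val-np-p4 g16, `symbolicDet_ne_zero_of_distinctAnchors`), sound for EVERY pair of injective enumerations

Helper file (`--supports stmt-ValiantsHypothesis-22510`; cell valiant-natproofs, rung V4; prover seat val-np-p1 gen 27; memo
HOME/val-np-p1/g27/MEMO-DA-profile2-valnp1-g27.md). Closes NO item.

WHY. The landed theorem `DistinctAnchors.symbolicDet_ne_zero_of_distinctAnchors` says: a bijection `σ` of rows and columns (`∅ ↔ ∅`)
together with PAIRWISE DISTINCT anchors `(A_k | B_k) ∈ anchors s h` inside the matched entries (`A_k ⊆ u k`, `B_k ⊆ w (σ k)`) makes the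
symbolic minor `symbolicDet s h r u w` nonzero — no determinant, no peeling. At profile `s = 2` this certificate exists for EVERY named pair
of the line's residual censuses (cube-minus-tops / punctured cubes versus truncated balls `tB(N,3)`, `tB(N,4)`, the graph pairs, the Golay
pair cube₁₁ / B(23,≤3) at r = 2048, and the doubly non-nested-Hall pair (Δ⁶ ⊔ 104 points, tB(11,3)) at r = 232 of memo g26 §1): a
max-flow computation (lab/da_flow.py: source → row → root `A ⊆ U` → block `B` (capacity 1 per label `(A,B)`) → column `W ⊇ B` → sink).
This file makes such certificates KERNEL-CHECKABLE: `DA.check h s rows cols cert` reads bitmask data — rows, columns, and one entry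
`(U, W, A, B)` per row (matched column `W`, label `(A | B)`) — and `DA.symbolicDet_ne_zero_of_check` concludes `symbolicDet s h r u w ≠ 0`
for every pair of injective enumerations `u`, `w` of the decoded families (the matching and the labels are transported along the
enumerations; `σ` is rebuilt with `Equiv.ofBijective`). Instances: `…DAInstances`.

READING (memo §2): for fixed `s` the certificate exists unless some sub-complex has more faces than available labels
(`#{A ∈ R, 1 ≤ |A| ≤ s} · #{B ∈ C, 1 ≤ |B| ≤ s}`-type Hall obstructions); at `s = 2` this puts every explicit residual pair of the line
inside the Hall regime of 𝔄₂, and the genuinely uncertified class (deep × wide pairs, e.g. cube_n versus tB(N,3)-type columns with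
n ≳ 28) beyond r ≈ 10⁸.

WHAT THIS IS NOT: no statement about pairs without such a certificate; nothing on crux stmt-ValiantsHypothesis-14610 or on `VP` versus `VNP`.
-/

set_option linter.dupNamespace false

namespace Summit.ValiantsHypothesis.ValiantsHypothesis.Theorems.BarrierLever.AnchoredPeeling

open Finset

namespace DA

variable {h : ℕ}

/-! ## 1. Distinct anchors from a matching given on the row indices -/

/-- **Distinct anchors, matching form.** Rows `u`, columns `w` (injective); a column VALUE `m k ∈ range w` for every row index, injective in `k`,
with `u k = ∅ ↔ m k = ∅`; labels `anc k ∈ anchors s h` inside `(u k, m k)` for the nonempty rows, pairwise distinct. Then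
`symbolicDet s h r u w ≠ 0`. (The bijection `σ` of `…DistinctAnchors` is `Equiv.ofBijective` of `k ↦` the index of `m k`.) -/
theorem symbolicDet_ne_zero_of_matching (s h r : ℕ) (u w : Fin r → Finset (Fin h))
    (hu : Function.Injective u) (hw : Function.Injective w)
    (m : Fin r → Finset (Fin h)) (hm : ∀ k, m k ∈ Set.range w) (hminj : Function.Injective m)
    (hempty : ∀ k, u k = ∅ ↔ m k = ∅) (anc : Fin r → Finset (Fin h) × Finset (Fin h))
    (hanc : ∀ k, u k ≠ ∅ → anc k ∈ anchors s h ∧ (anc k).1 ⊆ u k ∧ (anc k).2 ⊆ m k)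
    (hinj : ∀ k k', u k ≠ ∅ → u k' ≠ ∅ → anc k = anc k' → k = k') :
    symbolicDet s h r u w ≠ 0 := by
  classical
  choose g hg using hm
  have hginj : Function.Injective g := fun k k' hkk => hminj (by rw [← hg k, ← hg k', hkk])
  have hgbij : Function.Bijective g := Finite.injective_iff_bijective.mp hginj
  refine DistinctAnchors.symbolicDet_ne_zero_of_distinctAnchors s h r u w hu hw (Equiv.ofBijective g hgbij) ?_ anc ?_ hinj
  · intro k
    rw [Equiv.ofBijective_apply, hg]
    exact hempty k
  · intro k hk
    rw [Equiv.ofBijective_apply, hg]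
    exact hanc k hk

/-! ## 2. The checker -/

/-- One certificate entry `(U, W, A, B)` is well-formed at profile `s`: masks below `2^h`, `U = 0 ↔ W = 0`, and for `U ≠ 0` the label
`(A | B)` lies inside `(U, W)` with `1 ≤ |A|, |B| ≤ s`. -/
def entryOK (h s : ℕ) (e : ℕ × ℕ × ℕ × ℕ) : Bool :=
  decide (e.1 < 2 ^ h) && decide (e.2.1 < 2 ^ h) && decide (e.2.2.1 < 2 ^ h) && decide (e.2.2.2 < 2 ^ h) &&
  decide ((e.1 = 0) ↔ (e.2.1 = 0)) &&
  (decide (e.1 = 0) || (XElim.Check.subB e.2.2.1 e.1 && XElim.Check.subB e.2.2.2 e.2.1 &&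
    decide (1 ≤ XElim.Check.pc h e.2.2.1) && decide (XElim.Check.pc h e.2.2.1 ≤ s) &&
    decide (1 ≤ XElim.Check.pc h e.2.2.2) && decide (XElim.Check.pc h e.2.2.2 ≤ s)))

/-- **The distinct-anchor checker.** `rows`, `cols`: bitmask lists; `cert`: one entry `(U, W, A, B)` per row, in the order of `rows`. Accepts iff
the entries are well-formed, their row masks are `rows`, every matched column mask is in `cols`, the matched columns are pairwise distinct,
and the labels `(A, B)` of the nonzero rows are pairwise distinct. -/
def check (h s : ℕ) (rows cols : List ℕ) (cert : List (ℕ × ℕ × ℕ × ℕ)) : Bool :=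
  (cert.map (·.1) == rows) && cert.all (fun e => entryOK h s e && decide (e.2.1 ∈ cols)) &&
  decide ((cert.map (·.2.1)).Nodup) && decide (((cert.filter (fun e => !decide (e.1 = 0))).map (·.2.2)).Nodup)

/-! ## 3. Soundness -/

/-- Unpacking a well-formed entry. -/
theorem entryOK_iff {s : ℕ} {e : ℕ × ℕ × ℕ × ℕ} : entryOK h s e = true ↔
    e.1 < 2 ^ h ∧ e.2.1 < 2 ^ h ∧ e.2.2.1 < 2 ^ h ∧ e.2.2.2 < 2 ^ h ∧ ((e.1 = 0) ↔ (e.2.1 = 0)) ∧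
    (e.1 = 0 ∨ (XElim.Check.subB e.2.2.1 e.1 = true ∧ XElim.Check.subB e.2.2.2 e.2.1 = true ∧
      1 ≤ XElim.Check.pc h e.2.2.1 ∧ XElim.Check.pc h e.2.2.1 ≤ s ∧ 1 ≤ XElim.Check.pc h e.2.2.2 ∧ XElim.Check.pc h e.2.2.2 ≤ s)) := by
  simp only [entryOK, Bool.and_eq_true, Bool.or_eq_true, decide_eq_true_eq]
  tauto

/-- **SOUNDNESS.** An accepted certificate makes `symbolicDet s h r u w` nonzero for EVERY pair of injective enumerations `u`, `w` whose images
are the decoded row and column families. -/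
theorem symbolicDet_ne_zero_of_check {s : ℕ} {rows cols : List ℕ} {cert : List (ℕ × ℕ × ℕ × ℕ)}
    (hc : check h s rows cols cert = true) {r : ℕ} (u w : Fin r → Finset (Fin h))
    (hu : Function.Injective u) (hw : Function.Injective w)
    (hru : Set.range u = ↑(XElim.Check.dRows h rows)) (hrw : Set.range w = ↑(XElim.Check.dRows h cols)) :
    symbolicDet s h r u w ≠ 0 := by
  classical
  simp only [check, Bool.and_eq_true, decide_eq_true_eq, beq_iff_eq, List.all_eq_true] at hc
  obtain ⟨⟨⟨hrows, hall⟩, hnodW⟩, hnodL⟩ := hc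
  -- every row index has a certificate entry
  have hex : ∀ k, ∃ e ∈ cert, ofBits h e.1 = u k := by
    intro k
    have hk : u k ∈ (↑(XElim.Check.dRows h rows) : Set (Finset (Fin h))) := by rw [← hru]; exact ⟨k, rfl⟩
    rw [Finset.mem_coe, XElim.Check.dRows, List.mem_toFinset, List.mem_map] at hk
    obtain ⟨U, hU, hUk⟩ := hk
    rw [← hrows, List.mem_map] at hU
    obtain ⟨e, he, rfl⟩ := hU
    exact ⟨e, he, hUk⟩
  choose e he heu using hex
  have hok : ∀ k, (e k).1 < 2 ^ h ∧ (e k).2.1 < 2 ^ h ∧ (e k).2.2.1 < 2 ^ h ∧ (e k).2.2.2 < 2 ^ h ∧ (((e k).1 = 0) ↔ ((e k).2.1 = 0)) ∧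
      ((e k).1 = 0 ∨ (XElim.Check.subB (e k).2.2.1 (e k).1 = true ∧ XElim.Check.subB (e k).2.2.2 (e k).2.1 = true ∧
        1 ≤ XElim.Check.pc h (e k).2.2.1 ∧ XElim.Check.pc h (e k).2.2.1 ≤ s ∧ 1 ≤ XElim.Check.pc h (e k).2.2.2 ∧ XElim.Check.pc h (e k).2.2.2 ≤ s)) :=
    fun k => entryOK_iff.mp (hall (e k) (he k)).1
  have hcols : ∀ k, (e k).2.1 ∈ cols := fun k => (hall (e k) (he k)).2
  -- two row indices with the same entry coincide
  have hee : ∀ k k', e k = e k' → k = k' := by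
    intro k k' hkk
    apply hu
    rw [← heu k, ← heu k', hkk]
  have hU0 : ∀ k, u k ≠ ∅ → (e k).1 ≠ 0 := by
    intro k hk h0
    apply hk
    rw [← heu k, ofBits_eq_empty_iff (hok k).1]
    exact h0
  refine symbolicDet_ne_zero_of_matching s h r u w hu hw (fun k => ofBits h (e k).2.1) ?_ ?_ ?_
    (fun k => (ofBits h (e k).2.2.1, ofBits h (e k).2.2.2)) ?_ ?_
  · -- matched columns are columns
    intro k
    rw [hrw, Finset.mem_coe, XElim.Check.dRows, List.mem_toFinset, List.mem_map]
    exact ⟨(e k).2.1, hcols k, rfl⟩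
  · -- the matching is injective
    intro k k' hkk
    have hW : (e k).2.1 = (e k').2.1 := XElim.Check.ofBits_inj (hok k).2.1 (hok k').2.1 hkk
    exact hee k k' (List.inj_on_of_nodup_map hnodW (he k) (he k') hW)
  · -- matched emptiness
    intro k
    rw [← heu k, ofBits_eq_empty_iff (hok k).1, ofBits_eq_empty_iff (hok k).2.1]
    exact (hok k).2.2.2.2.1
  · -- labels are anchors inside the matched entries
    intro k hk
    rcases (hok k).2.2.2.2.2 with h0 | ⟨hA, hB, h1, h2, h3, h4⟩
    · exact absurd h0 (hU0 k hk)
    refine ⟨?_, ?_, ?_⟩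
    · simp only [anchors, Finset.mem_filter, Finset.mem_univ, true_and, XElim.Check.card_ofBits]
      exact ⟨h1, h2, h3, h4⟩
    · rw [← heu k]; exact (XElim.Check.subB_iff (hok k).2.2.1 (hok k).1).mp hA
    · exact (XElim.Check.subB_iff (hok k).2.2.2.1 (hok k).2.1).mp hB
  · -- labels of nonempty rows are distinct
    intro k k' hk hk' hkk
    have hmem : ∀ k, u k ≠ ∅ → e k ∈ cert.filter (fun e => !decide (e.1 = 0)) := by
      intro k hk
      rw [List.mem_filter]
      refine ⟨he k, ?_⟩
      simpa using hU0 k hk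
    have hlab : (e k).2.2 = (e k').2.2 := by
      obtain ⟨hA, hB⟩ := Prod.mk.inj hkk
      exact Prod.ext (XElim.Check.ofBits_inj (hok k).2.2.1 (hok k').2.2.1 hA) (XElim.Check.ofBits_inj (hok k).2.2.2.1 (hok k').2.2.2.1 hB)
    exact hee k k' (List.inj_on_of_nodup_map hnodL (hmem k hk) (hmem k' hk') hlab)

/-- **Soundness at every higher profile** (`symbolicDet_ne_zero_mono`). -/
theorem symbolicDet_ne_zero_of_check_mono {s s' : ℕ} (hss : s ≤ s') {rows cols : List ℕ} {cert : List (ℕ × ℕ × ℕ × ℕ)}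
    (hc : check h s rows cols cert = true) {r : ℕ} (u w : Fin r → Finset (Fin h))
    (hu : Function.Injective u) (hw : Function.Injective w)
    (hru : Set.range u = ↑(XElim.Check.dRows h rows)) (hrw : Set.range w = ↑(XElim.Check.dRows h cols)) :
    symbolicDet s' h r u w ≠ 0 :=
  symbolicDet_ne_zero_mono hss (symbolicDet_ne_zero_of_check hc u w hu hw hru hrw)

end DA

end Summit.ValiantsHypothesis.ValiantsHypothesis.Theorems.BarrierLever.AnchoredPeeling
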